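import Summits.HodgeConjecture.HodgeCM.PerL34.EndStateSeparation_1

/-! PORT of `HodgeCM/PerL34/EndStateSeparation.lean` (HodgeCMPerL run 82) — part 2: continuation of `Summits.HodgeConjecture.HodgeCM.PerL34.EndStateSeparation_1` (split at a top-level declaration boundary by port_pkg.py; scope re-opened below; declarations unchanged). -/

-- port_pkg: scope re-opened for this part (file-level context, then the namespace/section stack open at the cut)
set_option autoImplicit false
noncomputable section
namespace HodgeCM
namespace PerL34
namespace EndStateSeparation
open HodgeCM.Prior.Perl34File HodgeCM.Prior.Perl34File.Perl34 HodgeCM.PerL34.ArchC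
open HodgeCM.PerL34.EndStateStrength HodgeCM.PerL34.EndStateCensus HodgeCM.PerL34.CharSpansFinal
variable {U : Universe} (T : U.ThetaModel)
variable (hw : T.Open_thetaWedge)
/-- **`ThetaMeet` fails for the pinned model** (given skew-symmetry of `∪` on `H¹` and the two design
constraints, which produce a good context — Landherr's lemma is the theorem `lemma33bLandherr_holds`). -/
theorem pin_not_thetaMeet (hc1 : U.Fact_cup_comm1) (hκ : T.Design_kappaConj) (hs : T.Design_frameSignConj) :
    ¬ ThetaMeet (T.pin hw) := by
  intro hm
  obtain ⟨F, ι₁, V, c, hc⟩ := T.exists_goodCtx'' hκ hs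
  obtain ⟨Γ₀, hΓ₀⟩ := hm V c ((pin_goodCtx_iff T hw ι₁ c).mpr hc)
  have hne := hΓ₀ Γ₀ le_rfl
  rw [pin_meet_empty T hw hc1] at hne
  exact Set.not_nonempty_empty hne

/-- **The S1 binder of the headline fails for the pinned model.** -/
theorem pin_not_weilStepsInputCRΔ (hc1 : U.Fact_cup_comm1) (hκ : T.Design_kappaConj)
    (hs : T.Design_frameSignConj) (hch : T.Open_chars) : ¬ WeilStepsInputCRΔ (T.pin hw) := fun h =>
  pin_not_thetaMeet T hw hc1 hκ hs (thetaWedge_and_meet_of_CRΔ (T.pin hw) ((pin_chars_iff T hw).mpr hch) h).2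

/-- Likewise for the hereditary wedge-with-meet `Open_thetaWedgeHereditary`. -/
theorem pin_not_hereditary (hc1 : U.Fact_cup_comm1) (hκ : T.Design_kappaConj) (hs : T.Design_frameSignConj) :
    ¬ StepsVacuity.Open_thetaWedgeHereditary (T.pin hw) := fun h =>
  pin_not_thetaMeet T hw hc1 hκ hs ((hereditary_iff (T.pin hw)).mp h).2

/-- Hence the pinned model does NOT satisfy the headline's record bundle. -/
theorem pin_not_headlineBundle (hc1 : U.Fact_cup_comm1) (hκ : T.Design_kappaConj)
    (hs : T.Design_frameSignConj) (hch : T.Open_chars)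
    (Pc : ∀ {L : CMField} {ι₁ : L →+* ℂ} (V : HermSpace3 L ι₁) (c : SeesawCtx L),
      C4a.PointedCore (T.core V c)) :
    ¬ HeadlineBundle (T.pin hw) Pc := fun h =>
  pin_not_weilStepsInputCRΔ T hw hc1 hκ hs hch h.weil

/-! ## Packaged relative-consistency statements -/

/-- **The headline's other record binders + A6 do not imply `hW`.**  If `T` carries the model axioms, M38, the two
design constraints and the headline's record bundle, then re-choosing ONLY the theta one-forms gives a theta model
with the six other record binders, the PRINT typing facts of `T`, the design constraints and Prop 4.3's wedge (A6),
but with neither `ThetaMeet` nor `WeilStepsInputCRΔ` — so not the headline's bundle. -/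
theorem exists_records_thetaWedge_not_weil (M : U.ModelAxioms) (hM38 : U.Fact_cmInflation)
    (hκ : T.Design_kappaConj) (hs : T.Design_frameSignConj)
    (Pc : ∀ {L : CMField} {ι₁ : L →+* ℂ} (V : HermSpace3 L ι₁) (c : SeesawCtx L),
      C4a.PointedCore (T.core V c))
    (h : HeadlineBundle T Pc) :
    ∃ Θ : ∀ {L : CMField} {ι₁ : L →+* ℂ} (V : HermSpace3 L ι₁), SeesawCtx L → Fin 4 →
        ∀ Γ : Level V, Set (U.CohC (U.pms L ι₁ V Γ) 1),
      RecordsSansWeil (T.withTheta Θ) Pc ∧ (T.withTheta Θ).Open_thetaWedge ∧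
      ((T.withTheta Θ).Fact_embCover ↔ T.Fact_embCover) ∧ ((T.withTheta Θ).Fact_innerEmb ↔ T.Fact_innerEmb) ∧
      (T.withTheta Θ).Design_kappaConj ∧ (T.withTheta Θ).Design_frameSignConj ∧
      ¬ ThetaMeet (T.withTheta Θ) ∧ ¬ WeilStepsInputCRΔ (T.withTheta Θ) ∧
      ¬ HeadlineBundle (T.withTheta Θ) Pc := by
  have hw : T.Open_thetaWedge := (thetaWedge_and_meet_of_CRΔ T h.chars h.weil).1
  exact ⟨pinTheta T hw, pin_recordsSansWeil T M hM38 Pc (recordsSansWeil_of_headlineBundle T Pc h) hw,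
    pin_thetaWedge T hw, pin_embCover_iff T hw, pin_innerEmb_iff T hw, (pin_kappaConj_iff T hw).mpr hκ,
    (pin_frameSignConj_iff T hw).mpr hs, pin_not_thetaMeet T hw M.cup_comm1 hκ hs,
    pin_not_weilStepsInputCRΔ T hw M.cup_comm1 hκ hs h.chars,
    pin_not_headlineBundle T hw M.cup_comm1 hκ hs h.chars Pc⟩

/-- **The dictionary leaves without `ThetaMeet` do not imply `ThetaMeet`** (only `Fact_cup_comm1` and the design
constraints are used). -/
theorem exists_dictLeavesSansMeet_not_meet (hc1 : U.Fact_cup_comm1) (hκ : T.Design_kappaConj)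
    (hs : T.Design_frameSignConj)
    (Pc : ∀ {L : CMField} {ι₁ : L →+* ℂ} (V : HermSpace3 L ι₁) (c : SeesawCtx L),
      C4a.PointedCore (T.core V c))
    (h : DictLeavesSansMeet T Pc) :
    ∃ Θ : ∀ {L : CMField} {ι₁ : L →+* ℂ} (V : HermSpace3 L ι₁), SeesawCtx L → Fin 4 →
        ∀ Γ : Level V, Set (U.CohC (U.pms L ι₁ V Γ) 1),
      DictLeavesSansMeet (T.withTheta Θ) Pc ∧ ¬ ThetaMeet (T.withTheta Θ) ∧ ¬ DictLeaves (T.withTheta Θ) Pc :=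
  ⟨pinTheta T h.wedge, pin_dictLeavesSansMeet T Pc h, pin_not_thetaMeet T h.wedge hc1 hκ hs,
    fun h' => pin_not_thetaMeet T h.wedge hc1 hκ hs h'.meet⟩

/-- **The node leaves do not imply the S1 binder.** -/
theorem exists_nodeLeaves_not_weilStepsInputCRΔ (hc1 : U.Fact_cup_comm1) (hκ : T.Design_kappaConj)
    (hs : T.Design_frameSignConj) (h : NodeLeaves T) :
    ∃ T' : U.ThetaModel, NodeLeaves T' ∧ (T'.Fact_embCover ↔ T.Fact_embCover) ∧
      (T'.Fact_innerEmb ↔ T.Fact_innerEmb) ∧ T'.Design_kappaConj ∧ T'.Design_frameSignConj ∧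
      ¬ ThetaMeet T' ∧ ¬ WeilStepsInputCRΔ T' ∧ ¬ StepsVacuity.Open_thetaWedgeHereditary T' :=
  ⟨T.pin h.wedge, pin_nodeLeaves T h, pin_embCover_iff T h.wedge, pin_innerEmb_iff T h.wedge,
    (pin_kappaConj_iff T h.wedge).mpr hκ, (pin_frameSignConj_iff T h.wedge).mpr hs,
    pin_not_thetaMeet T h.wedge hc1 hκ hs, pin_not_weilStepsInputCRΔ T h.wedge hc1 hκ hs h.chars,
    pin_not_hereditary T h.wedge hc1 hκ hs⟩

/-! ## Why `ThetaMeet` holds in the intended model: the zero theta form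

`StepsVacuity` (header, (ii)): conjunct (ii) of the hereditary form "records `cls Γ 0 ∈ Θ₀(Γ) ∩ Θ₁(Γ)` (the zero
form lies in every span); in the intended model `0 = u_0 ∈ Θ_i(Γ)`".  KERNEL form of that remark: any theta model
whose theta sets of types `Ψ₀, Ψ₁` contain the zero class (e.g. are `ℂ`-subspaces) satisfies `ThetaMeet`, so for
such models the headline's `hW` is exactly A6 (with `EndStateStrength.weilStepsInputCRΔ_iff_thetaWedge`). -/

/-- "The zero class is a theta one-form of types `Ψ₀` and `Ψ₁` at every level of a good context." -/
def ZeroTheta : Prop :=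
  ∀ {L : CMField} {ι₁ : L →+* ℂ} (V : HermSpace3 L ι₁) (c : SeesawCtx L), T.GoodCtx ι₁ c →
    ∀ Γ : Level V, (0 : U.CohC (U.pms L ι₁ V Γ) 1) ∈ T.Theta V c 0 Γ ∧
      (0 : U.CohC (U.pms L ι₁ V Γ) 1) ∈ T.Theta V c 1 Γ

/-- `ZeroTheta T → ThetaMeet T` given A6 (which supplies a level in each good context; the zero class is then
the common element at every level below it). -/
theorem thetaMeet_of_zeroTheta (hw : T.Open_thetaWedge) (h0 : ZeroTheta T) : ThetaMeet T := by
  intro L ι₁ V c hc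
  obtain ⟨Γ₀, -⟩ := hw V c hc
  exact ⟨Γ₀, fun Γ _ => ⟨0, (h0 V c hc Γ).1, (h0 V c hc Γ).2⟩⟩

/-- Hence, inside the end state, **A6 + `ZeroTheta` manufacture the headline's S1 binder** (`C : SplitHolConfig`
is pv02-g3's `SplitHolForms.splitHolConfig` once `ClassVanishing` lands; cf. `EndStateVerdict`). -/
theorem weilStepsInputCRΔ_of_thetaWedge_of_zeroTheta (M : U.ModelAxioms) (hHR : U.Fact_hodgeRiemann20)
    (hE : T.Fact_embCover) (hI : T.Fact_innerEmb) (hsub : T.Open_thetaSub) (hgen : T.Open_thetaGen12)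
    (hch : T.Open_chars) (C : S1StrengthCR.SplitHolConfig) (hcov : T.Fact_coverTheta)
    (hw : T.Open_thetaWedge) (h0 : ZeroTheta T) : WeilStepsInputCRΔ T :=
  (weilStepsInputCRΔ_iff_thetaWedge T M hHR hE hI hsub hgen hch C hcov).2 ⟨hw, thetaMeet_of_zeroTheta T hw h0⟩

/-- The pinned model violates `ZeroTheta` (its type-`Ψ₀`/`Ψ₁` theta sets are disjoint). -/
theorem pin_not_zeroTheta (hc1 : U.Fact_cup_comm1) (hκ : T.Design_kappaConj) (hs : T.Design_frameSignConj) :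
    ¬ ZeroTheta (T.pin hw) := fun h0 =>
  pin_not_thetaMeet T hw hc1 hκ hs (thetaMeet_of_zeroTheta (T.pin hw) (pin_thetaWedge T hw) h0)

/-- **PerL is untouched**: the pinned model still yields `U.PerL` from the node leaves (the floor
`AssemblyNoLandherr.perL_of_nodes''`), although its S1 binder is false. -/
theorem pin_perL (M : U.ModelAxioms) (h07 : N07_hodgeRiemann20 U) (h09a : N09a_embCover T)
    (h09b : N09b_innerEmb T) (h12b : N12b_signRecipe T) (h : NodeLeaves T) : U.PerL :=
  perL_of_nodeLeaves M (T.pin h.wedge) h07 h09a h09b h12b (pin_nodeLeaves T h)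

end EndStateSeparation
end PerL34
end HodgeCM

end
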